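import Mathlib

/-!
# Tier3ContinuationFactorisation — the factorised Rallis pairing passes from `Re s > 1` to `s₀ = ½`
(T3.5 for T3.1; PERIOD-ADDENDUM-9 §A9.3 step 4)

Step 3 of §A9.3 shows, for `Re s > 1`, that the doubling zeta integral on the `τ`-isotypic block factors:
`Z(s, v₁ ⊗ e₁, v₂ ⊗ e₂) = ⟨τ(Φ_s) v₁, v₂⟩ · ⟨e₁, e₂⟩`.  Step 4 says: «both sides are meromorphic in `s`, so the
identity holds at `s₀ = ½` where `E` is holomorphic» — and defines `S(v₁, v₂)` as the value at `s₀` of the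
continued matrix-coefficient zeta integral, obtaining (★) `⟨θ(v₁ ⊗ e₁), θ(v₂ ⊗ e₂)⟩ = S(v₁, v₂) · ⟨e₁, e₂⟩`.
This file is the elementary content of that step: the identity principle for functions analytic off a
countable closed set `P ⊂ ℂ` of poles (`ℂ ∖ P` is connected — Mathlib's
`Set.Countable.isConnected_compl_of_one_lt_rank`; two such functions agreeing on a half-plane `Re s > a`
agree everywhere off `P` — `AnalyticOnNhd.eqOn_of_preconnected_of_eventuallyEq`), and its consequence for the
factorised shape: if `Z s x y` is analytic in `s` off `P` for all `x, y` and factors as `S s v₁ v₂ * B e₁ e₂`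
on the half-plane, then at every `s₀ ∉ P` it factors as `S₀ v₁ v₂ * B e₁ e₂` for some `S₀` — for an orthonormal
family `e i` exactly the hypothesis `hB` of Tier3MultiplicityTransfer (lifts of orthogonal copies are
orthogonal, all non-zero as soon as one is).  A vector `v ⊗ e` of the block is written as the pair `(v, e)`.
What stays on the page: the meromorphic continuation of the Siegel Eisenstein series and its holomorphy at
`s₀` (PRINTED — Bergeron Thm 4.3 = Ichino 2007; the hypothesis `hZ` below) and the unfolded identity for
`Re s > 1` (§A9.3 steps 2–3; the hypothesis `hfac`).  No definition, no notation, `import Mathlib` only.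
Nothing here asserts anything about the original programme; HC_CM is NOT proved by anyone in this repository.
-/

namespace HodgeRepro.T3P1.ContinuationFactorisation

open Set Filter Topology

/-- The complement of a countable subset of `ℂ` is preconnected (`ℂ` has real rank `2 > 1`). -/
theorem isPreconnected_compl_of_countable {P : Set ℂ} (hP : P.Countable) : IsPreconnected Pᶜ :=
  (hP.isConnected_compl_of_one_lt_rank
    (by simp only [Complex.rank_real_complex, Nat.one_lt_ofNat])).isPreconnected

/-- A closed discrete subset of `ℂ` — the polar set of a meromorphic function — is countable. -/
theorem countable_of_isClosed_of_discrete {P : Set ℂ} (hP : IsClosed P) (hd : DiscreteTopology P) :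
    P.Countable :=
  hP.isLindelof.countable hd

/-- The open half-plane `Re s > a` is not contained in any countable set: it has a point off `P`. -/
theorem exists_re_gt_notMem {P : Set ℂ} (hP : P.Countable) (a : ℝ) :
    ∃ s : ℂ, a < s.re ∧ s ∉ P := by
  by_contra h
  push Not at h
  -- the vertical line `Re s = a + 1` injects `ℝ` into the half-plane
  set f : ℝ → ℂ := fun t => ((a + 1 : ℝ) : ℂ) + (t : ℂ) * Complex.I with hf
  have hinj : Function.Injective f := by
    intro t₁ t₂ h12
    have h' := congrArg Complex.im h12
    simpa [hf] using h'
  have hsub : (univ : Set ℝ) ⊆ f ⁻¹' P := by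
    intro t _
    apply h
    simp [hf]
  exact Cardinal.not_countable_real (Set.Countable.mono hsub (hP.preimage hinj))

/-- **The identity principle from an open piece.** Two functions analytic on a preconnected `U ⊆ ℂ`
that agree on a non-empty open `V ⊆ U` agree on all of `U`. -/
theorem eqOn_of_eqOn_isOpen {U V : Set ℂ} {F G : ℂ → ℂ} (hU : IsPreconnected U)
    (hF : AnalyticOnNhd ℂ F U) (hG : AnalyticOnNhd ℂ G U) (hV : IsOpen V) (hVU : V ⊆ U)
    (hne : V.Nonempty) (h : EqOn F G V) : EqOn F G U := by
  obtain ⟨z₀, hz₀⟩ := hne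
  exact hF.eqOn_of_preconnected_of_eventuallyEq hG hU (hVU hz₀)
    (Filter.eventuallyEq_of_mem (hV.mem_nhds hz₀) h)

/-- **Continuation of an identity from a half-plane.** If `F`, `G` are analytic off a countable closed
set `P ⊂ ℂ` and agree on the half-plane `Re s > a` (off `P`), they agree at every `s₀ ∉ P`. -/
theorem eq_of_eqOn_halfplane {P : Set ℂ} (hPc : P.Countable) (hPcl : IsClosed P) {F G : ℂ → ℂ}
    (hF : AnalyticOnNhd ℂ F Pᶜ) (hG : AnalyticOnNhd ℂ G Pᶜ) {a : ℝ}
    (h : ∀ s : ℂ, a < s.re → s ∉ P → F s = G s) {s₀ : ℂ} (hs₀ : s₀ ∉ P) : F s₀ = G s₀ := by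
  have hV : IsOpen ({s : ℂ | a < s.re} ∩ Pᶜ) :=
    (isOpen_lt continuous_const Complex.continuous_re).inter hPcl.isOpen_compl
  obtain ⟨s₁, hs₁a, hs₁P⟩ := exists_re_gt_notMem hPc a
  exact eqOn_of_eqOn_isOpen (isPreconnected_compl_of_countable hPc) hF hG hV inter_subset_right
    ⟨s₁, hs₁a, hs₁P⟩ (fun s hs => h s hs.1 hs.2) hs₀

/-- The same for a closed DISCRETE polar set (the shape a meromorphic function provides). -/
theorem eq_of_eqOn_halfplane_of_discrete {P : Set ℂ} (hPcl : IsClosed P) (hd : DiscreteTopology P)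
    {F G : ℂ → ℂ} (hF : AnalyticOnNhd ℂ F Pᶜ) (hG : AnalyticOnNhd ℂ G Pᶜ) {a : ℝ}
    (h : ∀ s : ℂ, a < s.re → s ∉ P → F s = G s) {s₀ : ℂ} (hs₀ : s₀ ∉ P) : F s₀ = G s₀ :=
  eq_of_eqOn_halfplane (countable_of_isClosed_of_discrete hPcl hd) hPcl hF hG h hs₀

/-- With a constant factor: `F = c · G` on the half-plane ⇒ `F s₀ = c · G s₀`. -/
theorem eq_mul_of_eqOn_halfplane {P : Set ℂ} (hPc : P.Countable) (hPcl : IsClosed P) {F G : ℂ → ℂ}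
    (hF : AnalyticOnNhd ℂ F Pᶜ) (hG : AnalyticOnNhd ℂ G Pᶜ) (c : ℂ) {a : ℝ}
    (h : ∀ s : ℂ, a < s.re → s ∉ P → F s = c * G s) {s₀ : ℂ} (hs₀ : s₀ ∉ P) :
    F s₀ = c * G s₀ :=
  eq_of_eqOn_halfplane hPc hPcl hF (analyticOnNhd_const.mul hG) h hs₀

/-- Vanishing on the half-plane continues: `F = 0` on `Re s > a` (off `P`) ⇒ `F s₀ = 0`. -/
theorem eq_zero_of_eqOn_halfplane_zero {P : Set ℂ} (hPc : P.Countable) (hPcl : IsClosed P)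
    {F : ℂ → ℂ} (hF : AnalyticOnNhd ℂ F Pᶜ) {a : ℝ} (h : ∀ s : ℂ, a < s.re → s ∉ P → F s = 0)
    {s₀ : ℂ} (hs₀ : s₀ ∉ P) : F s₀ = 0 :=
  eq_of_eqOn_halfplane hPc hPcl hF analyticOnNhd_const h hs₀

section Factorisation

variable {τ M : Type*}

/-- **The factorised shape continues (PERIOD-ADDENDUM-9 §A9.3 step 4).** Let `Z s x y` be the pairing at
`s` of two vectors of the block (`x = (v, e)` standing for `v ⊗ e`), analytic in `s` off a countable closed
`P`, and suppose it factors on the half-plane `Re s > a`: `Z s (v₁, e₁) (v₂, e₂) = S s v₁ v₂ * B e₁ e₂`.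
Then at every `s₀ ∉ P` it factors: there is `S₀` with `Z s₀ (v₁, e₁) (v₂, e₂) = S₀ v₁ v₂ * B e₁ e₂` —
(★) at `s₀`, with `S₀` the value there of the continued matrix-coefficient zeta integral. -/
theorem exists_factorisation_of_eqOn_halfplane {P : Set ℂ} (hPc : P.Countable) (hPcl : IsClosed P)
    (Z : ℂ → τ × M → τ × M → ℂ) (S : ℂ → τ → τ → ℂ) (B : M → M → ℂ)
    (hZ : ∀ x y, AnalyticOnNhd ℂ (fun s => Z s x y) Pᶜ) {a : ℝ}
    (hfac : ∀ s : ℂ, a < s.re → s ∉ P →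
      ∀ v₁ v₂ e₁ e₂, Z s (v₁, e₁) (v₂, e₂) = S s v₁ v₂ * B e₁ e₂)
    {s₀ : ℂ} (hs₀ : s₀ ∉ P) :
    ∃ S₀ : τ → τ → ℂ, ∀ v₁ v₂ e₁ e₂, Z s₀ (v₁, e₁) (v₂, e₂) = S₀ v₁ v₂ * B e₁ e₂ := by
  by_cases hB : ∃ e e', B e e' ≠ 0
  · obtain ⟨e, e', hee'⟩ := hB
    refine ⟨fun v₁ v₂ => Z s₀ (v₁, e) (v₂, e') / B e e', fun v₁ v₂ e₁ e₂ => ?_⟩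
    -- `F s := Z s (v₁, e₁) (v₂, e₂) * B e e'` and `G s := Z s (v₁, e) (v₂, e') * B e₁ e₂` agree for
    -- `Re s > a` (both equal `S s v₁ v₂ * B e₁ e₂ * B e e'`), hence at `s₀`.
    have key : Z s₀ (v₁, e₁) (v₂, e₂) * B e e' = Z s₀ (v₁, e) (v₂, e') * B e₁ e₂ := by
      refine eq_of_eqOn_halfplane hPc hPcl ((hZ _ _).mul analyticOnNhd_const)
        ((hZ _ _).mul analyticOnNhd_const) (a := a) (fun s hs hsP => ?_) hs₀
      simp only [hfac s hs hsP]
      ring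
    rw [div_mul_eq_mul_div, eq_div_iff hee']
    exact key
  · push Not at hB
    refine ⟨fun _ _ => 0, fun v₁ v₂ e₁ e₂ => ?_⟩
    rw [hB e₁ e₂, mul_zero]
    exact eq_zero_of_eqOn_halfplane_zero hPc hPcl (hZ _ _) (a := a)
      (fun s hs hsP => by rw [hfac s hs hsP, hB, mul_zero]) hs₀

/-- Lifts of orthogonal copies are orthogonal at `s₀`: `B e₁ e₂ = 0` ⇒ `Z s₀ (v₁, e₁) (v₂, e₂) = 0`. -/
theorem eq_zero_of_pairing_eq_zero {P : Set ℂ} (hPc : P.Countable) (hPcl : IsClosed P)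
    (Z : ℂ → τ × M → τ × M → ℂ) (S : ℂ → τ → τ → ℂ) (B : M → M → ℂ)
    (hZ : ∀ x y, AnalyticOnNhd ℂ (fun s => Z s x y) Pᶜ) {a : ℝ}
    (hfac : ∀ s : ℂ, a < s.re → s ∉ P →
      ∀ v₁ v₂ e₁ e₂, Z s (v₁, e₁) (v₂, e₂) = S s v₁ v₂ * B e₁ e₂)
    {s₀ : ℂ} (hs₀ : s₀ ∉ P) {e₁ e₂ : M} (h0 : B e₁ e₂ = 0) (v₁ v₂ : τ) :
    Z s₀ (v₁, e₁) (v₂, e₂) = 0 :=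
  eq_zero_of_eqOn_halfplane_zero hPc hPcl (hZ _ _) (a := a)
    (fun s hs hsP => by rw [hfac s hs hsP, h0, mul_zero]) hs₀

/-- **The orthonormal form — the hypothesis `hB` of Tier3MultiplicityTransfer at `s₀`.** For an
orthonormal family `e i` of the multiplicity space (`B (e i) (e j) = if i = j then 1 else 0`) the
continued pairing of the copies is `Z s₀ (v, e i) (w, e j) = if i = j then S₀ v w else 0`. -/
theorem exists_forall_ite_of_orthonormal {P : Set ℂ} (hPc : P.Countable) (hPcl : IsClosed P)
    (Z : ℂ → τ × M → τ × M → ℂ) (S : ℂ → τ → τ → ℂ) (B : M → M → ℂ)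
    (hZ : ∀ x y, AnalyticOnNhd ℂ (fun s => Z s x y) Pᶜ) {a : ℝ}
    (hfac : ∀ s : ℂ, a < s.re → s ∉ P →
      ∀ v₁ v₂ e₁ e₂, Z s (v₁, e₁) (v₂, e₂) = S s v₁ v₂ * B e₁ e₂)
    {s₀ : ℂ} (hs₀ : s₀ ∉ P) {ι : Type*} [DecidableEq ι] (e : ι → M)
    (he : ∀ i j, B (e i) (e j) = if i = j then 1 else 0) :
    ∃ S₀ : τ → τ → ℂ, ∀ i j v w, Z s₀ (v, e i) (w, e j) = if i = j then S₀ v w else 0 := by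
  obtain ⟨S₀, hS₀⟩ := exists_factorisation_of_eqOn_halfplane hPc hPcl Z S B hZ hfac hs₀
  refine ⟨S₀, fun i j v w => ?_⟩
  rw [hS₀, he]
  split_ifs <;> simp

end Factorisation

end HodgeRepro.T3P1.ContinuationFactorisation
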